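import Summits.QuantumFields.BalabanUV.T4Continuum.Spine.NE1p.DressedRootSameLattice
import Summits.QuantumFields.BalabanUV.T4Continuum.Spine.NE1p.DressedStabilityOfSuppliedSchedules
import Summits.QuantumFields.BalabanUV.T4Continuum.Spine.NE1p.DressedBirthRStepAnchored

/-!
# T⁴ programme, spine estimate NE1′ (node O3b/H2) — THE SUPPLIED SAME-LATTICE TERMINAL FACE: END-ALL ∘ suppliers ON THE OWNER'S
# SAME-LATTICE FACE, with the (I4′) SOCKET (two-sided based-plaquette regularity of the attaining pairs, per-generation normalisation)

Cell `pub-balaban`, sub-cell `t4`, BINDER-OWNERS row NE1′ (owner lineage t4-ne1p-p1), formalisation crew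
`b2b-balaban-t4-ne1p-formalise-*`, seat `leaf-04` (gen 7; lineage S1 ∕ S1b ∕ S1d ∕ S1e ∕ S1g ∕ S9 ∕ W13 ∕ S3t); row S3v of
`t4/formal/NE1p/LEAVES.md` (OFFERED typer R-T75 (ii), first refusal leaf-04-g7; INTENT `CLAIMS.log` l.13407; BOOKED R-T77 (i), conditions (a)–(f); X-label X92).
ADDITIVE — imports the owner's `Spine/NE1p/DressedRootSameLattice` (N0f, p218843: the same-lattice face of the composition route over
row S3-sup's `uniformConstantsOf` ∕ `bookingLeavesOf` through N0e), the crew's row S3i `Spine/NE1p/DressedStabilityOfSuppliedSchedules`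
(p214477: `count_of_anchoring_cell` ∕ `positionalCount_of_anchoring_cell`) and row S5e `Spine/NE1p/DressedBirthRStepAnchored`
(p214587: `hbirth_of_rstep_anchored`; through it rows S5 ∕ S5b ∕ S4) ONLY; THEOREMS ONLY (no `def`, no `def … : Prop`); modifies
nothing.  PATTERN of row S3u `Spine/NE1p/DressedStabilityStrictOfSuppliedComposition` (p218916, leaf-09-g5: the same service on N0e
with the L-V socket) — not imported (its supplier glue is inlined in its END bodies); nothing of it is copied beyond the three
supplier applications it shares with every END-ALL ∘ suppliers face.  NO binder of the density layer (α′) enters the statements: no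
`wOp`, no `RealBaseAt` ∕ `ExponentSliceAt`, no window schedule, no scale-indexed carried function, no (VAL-θ) ∕ L-V binder.

WHY.  The owner's g25 module N0f types the SAME-LATTICE READING of [Balaban1987RGI] (1.6) p. 261 ∕ p. 263 ∕ (3.39) p. 278 (memo
`OWNER-ANSWERS-g25.md` §2; renders read by the owner; TYPE ∕ CONTEXT only, nothing used as a hypothesis-free fact): the carried function
of generation `(b,k′)` is ONE function `Fn b k′` of the finest-lattice configuration at every later scale, its birth slice is asked AT
BIRTH ONLY on the generation's own chart (window `w b k′`, radius `r b k′`), and the transport input is the NORMALISED defect of the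
attaining pairs `defect b k′ k ≤ c_δ · r b k′ · ψ^(k−k′)`, `ψ = L⁻²` — displayed ON THE LATTICE (N0f §3 `hlin_of_twoSidedRegularity`)
as TWO-SIDED LEVEL REGULARITY of a unitary-like attaining pair on the generation's block with the per-generation normalisation
`(d−1)(Lg b k′ − 1)(a₁ b k′ + a₀ b k′) ≤ c_δ · r b k′` (the two-sided regularity has the printed TYPE [Balaban1985Variational] Thm 1 (8)
for Bałaban's minimisers — a HYPOTHESIS here; the RATE `ψ = (L²)⁻¹` at which `hpair`'s plaquette bounds and the defect decay is THE
CELL'S OWN RATE — the shape N0f's `hrate` consumes, a kernel consequence of the (I4′) binders AS DISPLAYED, NOT a printed constant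
(t4-ref2 pass 73, C-t4r2-343 (m7)); [Balaban1987RGI] (1.17)∕(3.41)∕(3.47) and the birth-constant smallness of the TYPE «B₃²O(1)Mα₀ <
½α₁» p. 277 are LOCI read by the owner, TYPE ∕ CONTEXT only — ASSERTED HERE FOR NOTHING).  N0f's ROOT-C face
`dressedStabilityStrict_of_sameLattice` displays, per `(p, K)`, the structural families `hS`∕`hcount` (w3-book), `hbirth` (L-B) and the
chart-level `hdefw`∕`hrate`∕`hlin`.  THIS FILE is the crew's END-ALL ∘ suppliers service on that face (v1.1 = v1 + THIS docstring
precision, (m7); every declaration byte-identical):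

* §1 `dressedStabilityStrict_of_suppliedSameLattice : DressedStabilityStrict 𝒯 (L ^ 4)` — N0f's `dressedStabilityStrict_of_sameLattice`
  BY NAME, ONE application, with `hS`∕`hcount` ⇐ the anchoring DATA (row S3i `count_of_anchoring_cell`: blocking integer `Lb` with
  `(Lb:ℝ) = L`, multiplicity `mB`, housing in met components of volume `≤ v`, `v·mB ≤ N₀` — SO `Λ = L ^ 4` IS THIS FACE'S OWN COUNT
  RATE, referee caveat k4), `hbirth` ⇐ THE ℝ-STEP ANCHORED SEAM (row S5e `hbirth_of_rstep_anchored` at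
  `uniformConstantsOf L 1 (4c_δ) c̄ N₀ A₀ m s̄⁰ ρ′`: ONE `Rs p K : RStep` per run parameter and cutoff, `CompVol vR`, `PreBelowEnv`,
  `AbsorbLaw` (w5b), dressing sizes `β j ≤ β₀·(L⁻³)^(K−j)`, row S5b's located numbers `fanout A (vR·mB) ρ′ < 1`,
  `absorbAmplitude β₀ A (vR·mB) ρ′ ≤ A₀` via `absorbSmall_of_le`), and THE (I4′) SOCKET: `hlin` ⇐ N0f §3 `hlin_of_twoSidedRegularity`,
  `hdefw` ⇐ N0f §3 `hdefw_of_window` BY NAME, `hrate` by `le_rfl`, for the chart `(latMove, latN)` of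
  `Literature.….T4BlockTransport`, the block relation `rel p K b k′ := BlockRel (Lg p K b k′) (zg p K b k′)` and the defect SET TO
  `c_δ · r p K b k′ · (L⁻²)^(k−k′)`.  What becomes DISPLAYED instead of `hdefw`∕`hrate`∕`hlin`: per generation the block data `Lg`∕`zg`,
  the based-plaquette amplitudes `a₀ a₁` with `0 < a₁ + a₀` (`ha`), the radius `r > 0` (`hr`), the normalisation `hnorm`, the window
  smallness `c_δ · r ≤ w` (`hw`), and — under the dressed history, up to every `ε > 0` — the attaining UNITARY-LIKE pair, base in the
  regular set, BOTH partners level-regular on the block at the generation-relative rate, realising the booked size (`hpair`, N0f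
  l.259–266 shape ∀ (p,K)).  N0f's other function-level binders stay displayed VERBATIM: `Fn`, `𝒦`, `w`, `hinv` (for `BlockRel`), `hsl`
  AT BIRTH on `(latMove, latN)`; `hmove` is `T4BlockTransport.latMove_zero`.
* §2 the headline `dressedStability_of_suppliedSameLattice : DressedStability 𝒯` and ROOT-B `dressedBudget_of_suppliedSameLattice :
  DressedBudget 𝒯 wt` — N0f's `dressedStability_of_sameLattice_strict` ∕ `dressedBudget_of_sameLattice_strict` BY NAME, the bookings'
  positional count read off the SAME anchoring (S3i `positionalCount_of_anchoring_cell`, `1 ≤ v` so that `mB ≤ v·mB ≤ N₀`).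
  Scalars ONCE before `∀ p K` (k1): `L c_δ c̄ N₀ A₀ m s̄⁰ ρ′ A β₀`, `Lb mB v vR`; the located largeness AT CONTINUATION FACTOR ONE
  `hloc : locOf L 1 (4c_δ) c̄ ≤ ρ′ < 1` — NO `e³`, NO radius (it cancels per generation, N0f §1), NO numeral `L` (k2: `Lb` is the
  anchoring's blocking integer with `(Lb:ℝ) = L`, a binder); `0 < c_δ` strict (N0f §3's crude comb-gauge bound needs a positive window).
  §3 one `example`: the scalar door at `2 ≤ L`, `16·L·c_δ·c̄ ≤ 1` (`locOf_one_le_of_small`, `ρ′ = 3∕4`).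

DISPLAYED, NEVER DISCHARGED (the walls of record): F-1 at birth (w1) `hsl` + invariance `hinv`; (I4′) as the two-sided regularity of
the attaining pairs `hpair` with `ha`∕`hnorm`∕`hw`∕`hr` (printed TYPE for Bałaban's backgrounds — a HYPOTHESIS for the cell's dressed run;
collar ∕ domain-match bookkeeping (O2e) unchanged); (w5) `hreg`; (w5b) `hlaw` with the seam `hpre` and sizes `hβ`; margins `hs₀` (free
to be `≡ 0` on this route); the anchoring ∕ component ∕ ℝ-step DATA.  Headline (c4): «ROOT-C OF RECORD on the same-lattice face ⇐
(I4′) ∧ (w1) ∧ (w5)∕(w5b) ∧ anchoring DATA — a REDUCTION BY NAME; NE1′ NOT proved; the same-lattice READING and wall v1.5-proposed are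
the owner's, of record only on the second reading (dagwriter `t4/T4-DAG.md` v32 Q42 (b))»; the (I4′) socket = wall v1.5-proposed's leaf-T
binder of PRINTED TYPE ([Balaban1985Variational] Thm 1 (8)), never discharged here.

HONEST FRAMING.  Kernel REDUCTION ∕ bookkeeping over hypothesis SHAPES ([folklore]; 0 sorry; 0 citations used as facts; no `def`, NO
`def … : Prop`; no estimate, no new analytic content).  Whether the dressed run's observable-attached terms may be booked on the
same-lattice face is the OWNER's READING (memo g25 §2), UNGRADED at filing (two-reader rule: X90 + t4-ref2) — not a theorem; if the
reading fails the file stays an admissible reduction BY NAME (nothing asserted).  0 binders instantiated on Bałaban's densities,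
backgrounds or value maps; `FlowStep.BetaPertH` ∕ (B) ∕ G-an2-4 enter nowhere.  NE1′ NOT printed, NOT proved; spine PROVED 0∕9.  Rung
(B)+1 on ONE finite four-torus — NOT infinite volume, NOT a mass gap, NOT OS on ℝ⁴, NOT the Clay problem.  HONEST DEPENDENCY:
continuum YM on T⁴ ⇐ BetaPertH ∧ nine spine estimates (0/9 proved); BetaPertH ⇐ (D1) ∧ (D4) ∧ CAP+tail; G-an2-4 gates asym, D1 and
NE2/3/4.
-/

noncomputable section

namespace Summit.QuantumFields.BalabanUV.T4Continuum.NE1p.DressedStabilityStrictOfSuppliedSameLattice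

open Set Finset
open scoped BigOperators
open Literature.MathematicalPhysics.QuantumFieldTheory.Balaban1983to89
open Literature.MathematicalPhysics.QuantumFieldTheory.Balaban1983to89.T4TermFormat
open Literature.MathematicalPhysics.QuantumFieldTheory.Balaban1983to89.T4FeltGeometry
open Literature.MathematicalPhysics.QuantumFieldTheory.Balaban1983to89.T4TrajectoryComparison
open Literature.MathematicalPhysics.QuantumFieldTheory.Balaban1983to89.T4BirthChartTransport
  (GaugeInvariant BirthSlice RelGauge)
open Literature.MathematicalPhysics.QuantumFieldTheory.Balaban1983to89.T4PreservedUnderR (RStep)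
open Literature.MathematicalPhysics.QuantumFieldTheory.Balaban1983to89.T4RelativeLadder (UnitaryLike)
open Literature.MathematicalPhysics.QuantumFieldTheory.Balaban1983to89.T4RelativeComb (Cfg plaq PlaqSup)
open Literature.MathematicalPhysics.QuantumFieldTheory.Balaban1983to89.T4BlockTransport
  (Site Fld NDir val latMove latN latMove_zero BlockRel)
open Summit.QuantumFields.BalabanUV.T4Continuum.T4TrajectoryDensityDressed
open Summit.QuantumFields.BalabanUV.T4Continuum.NE1p.DressedRoot
open Summit.QuantumFields.BalabanUV.T4Continuum.NE1p.DressedUniformConstants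
open Summit.QuantumFields.BalabanUV.T4Continuum.NE1p.DressedRootComposition
open Summit.QuantumFields.BalabanUV.T4Continuum.NE1p.DressedRootSameLattice
open Summit.QuantumFields.BalabanUV.T4Continuum.NE1p.DressedBirthSuppliers
open Summit.QuantumFields.BalabanUV.T4Continuum.NE1p.DressedAbsorptionWindow
open Summit.QuantumFields.BalabanUV.T4Continuum.NE1p.DressedPositionalCount
open Summit.QuantumFields.BalabanUV.T4Continuum.NE1p.DressedBirthRStepAnchored
open Summit.QuantumFields.BalabanUV.T4Continuum.NE1p.DressedStabilityOfSuppliedSchedules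

/-! ## §1 END-ALL ∘ SUPPLIERS ON THE SAME-LATTICE FACE: ROOT-C of record through the (I4′) socket -/

section EndAll

variable {P : Type*} (𝒯 : DressedTower P)
variable {R : Type*} [NormedRing R] [NormOneClass R] [NormedAlgebra ℂ R] {d : ℕ}
  {F : Type*} [NormedAddCommGroup F] [NormedSpace ℂ F] [CompleteSpace F]
variable {L cδ cbar N₀ A₀ m sbar ρ' A β₀ : ℝ} {Lb mB v vR : ℕ}
-- the same-lattice function-level data per run parameter and cutoff: ONE carried function per generation on the finest-lattice bond
-- fields, its regular set and window, the generation's block (side, corner), based-plaquette amplitudes and chart radius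
variable {Fn : ∀ (p : P) (K : ℕ), (𝒯.B p K).Birth → ℕ → Fld d R → F}
  {𝒦 : ∀ (p : P) (K : ℕ), (𝒯.B p K).Birth → ℕ → Set (Fld d R)}
  {w r a₀ a₁ : ∀ (p : P) (K : ℕ), (𝒯.B p K).Birth → ℕ → ℝ}
  {Lg : ∀ (p : P) (K : ℕ), (𝒯.B p K).Birth → ℕ → ℕ}
  {zg : ∀ (p : P) (K : ℕ), (𝒯.B p K).Birth → ℕ → Site d}
-- the booking-level data: regeneration constants, margins, live families, anchoring, components, the ℝ-steps, dressing sizes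
variable {c : P → ℕ → ℕ → ℝ} {s₀ : ∀ (p : P) (K : ℕ), (𝒯.B p K).Birth → ℕ → ℝ}
  {S : ∀ (p : P) (K : ℕ), ℕ → (𝒯.B p K).Birth → Finset (𝒯.B p K).Birth}
variable (Anch : ∀ (p : P) (K : ℕ), Anchoring (𝒯.B p K) 4 Lb)
  {comp : ∀ (p : P) (K : ℕ), ℕ → (𝒯.B p K).Birth → Finset (𝒯.B p K).Cube}
  (Rs : ∀ (p : P) (K : ℕ), RStep (𝒯.B p K))
  {β : P → ℕ → ℕ → ℝ}

-- the located scalars AT CONTINUATION FACTOR ONE ((w7) largeness without `e³` and without a radius, (w6) window) and signs — ONCE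
variable (hL : 1 ≤ L) (hcδ : 0 < cδ) (hcbar : 0 ≤ cbar) (hN₀ : 0 ≤ N₀) (hA₀ : 0 ≤ A₀) (hm : 0 ≤ m)
variable (hloc : locOf L 1 (4 * cδ) cbar ≤ ρ') (hρ'1 : ρ' < 1) (hsmall : m * (N₀ * A₀ * (1 - ρ')⁻¹) ≤ 1 - sbar)
-- (w1) F-1 AT THE BIRTH SCALE ONLY on the generation's own lattice chart, and F-9 invariance under the generation's block relation
variable (hsl : ∀ (p : P) (K : ℕ) (b : (𝒯.B p K).Birth) (k' : ℕ), (𝒯.B p K).birthScale b ≤ k' → k' ≤ (𝒯.B p K).K →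
  RanBelow (budgetGate (𝒯.T p K) (s₀ p K) m (S p K) (4 * cδ) (fun _ : ℕ => (L ^ 2)⁻¹ * 1)) k' →
  BirthSlice (Fn p K b k') latMove latN (𝒦 p K b k') (w p K b k') (r p K b k') ((𝒯.T p K).gen b k'))
variable (hinv : ∀ p K b k', GaugeInvariant (BlockRel (R := R) (Lg p K b k') (zg p K b k')) (Fn p K b k'))
-- THE (I4′) SOCKET, per generation: positive radius, positive total amplitude, the per-generation NORMALISATION, the window smallness;
-- the normalisation `hnorm` and the attaining two-sided-regular unitary-like pair `hpair` sit in each theorem's HEADER below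
-- (the face's signature content; typer R-T77 (i)(c))
variable (hr : ∀ p K b k', 0 < r p K b k') (ha : ∀ p K b k', 0 < a₁ p K b k' + a₀ p K b k')
variable (hw : ∀ p K b k', cδ * r p K b k' ≤ w p K b k')
-- (w5) regeneration, margins
variable (hc0 : ∀ p K k, 0 ≤ c p K k) (hcb : ∀ p K k, k < (𝒯.B p K).K → c p K k ≤ cbar)
variable (hs₀ : ∀ p K b k, s₀ p K b k ≤ sbar)
variable (hreg : ∀ p K, (𝒯.T p K).RegeneratesFromVar (c p K)
  (budgetGate (𝒯.T p K) (s₀ p K) m (S p K) (4 * cδ) (fun _ : ℕ => (L ^ 2)⁻¹ * 1)))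
-- (w3-book) L-C REPLACED BY ANCHORING DATA (row S4): blocking integer, multiplicity, housing, component volume
variable (hLb : (Lb : ℝ) = L)
variable (hmult : ∀ (p : P) (K : ℕ), ∀ j (x : Fin 4 → ℕ),
  ((𝒯.B p K).births.filter fun b => (𝒯.B p K).birthScale b = j ∧ x ∈ (Anch p K).dom b).card ≤ mB)
variable (hscale : ∀ (p : P) (K : ℕ), ∀ k b, ∀ q ∈ comp p K k b, (𝒯.B p K).cubeScale q = k)
variable (hhoused : ∀ (p : P) (K : ℕ), ∀ k b, ∀ f ∈ S p K k b, ∃ q ∈ comp p K k b, f ∈ (𝒯.B p K).feltAt q)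
variable (hvol : ∀ (p : P) (K : ℕ), ∀ k b, (comp p K k b).card ≤ v) (hvN₀ : (v : ℝ) * mB ≤ N₀)
-- (w1)+(w5b) L-B THROUGH THE ℝ-STEP ANCHORED SEAM (row S5e): component volume, pre-ℝ sizes below the envelope, absorption law, sizes
variable (hcv : ∀ (p : P) (K : ℕ), (Rs p K).CompVol vR)
variable (hpre : ∀ (p : P) (K : ℕ), (𝒯.T p K).PreBelowEnv (Rs p K) (4 * cδ) (fun _ : ℕ => (L ^ 2)⁻¹ * 1)
  (budgetGate (𝒯.T p K) (s₀ p K) m (S p K) (4 * cδ) (fun _ : ℕ => (L ^ 2)⁻¹ * 1)))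
variable (hA : 0 ≤ A) (hlaw : ∀ (p : P) (K : ℕ), (𝒯.T p K).AbsorbLaw (Rs p K) (4 * cδ) (β p K) A)
variable (hβ : ∀ (p : P) (K : ℕ), ∀ j, j ≤ (𝒯.B p K).K → β p K j ≤ β₀ * (L⁻¹ ^ 3) ^ ((𝒯.B p K).K - j))
variable (hfan : fanout A ((vR : ℝ) * mB) ρ' < 1) (hamp : absorbAmplitude β₀ A ((vR : ℝ) * mB) ρ' ≤ A₀)

include hL hcδ hcbar hN₀ hA₀ hm hloc hρ'1 hsmall hsl hinv hr ha hw hc0 hcb hs₀ hreg hLb hmult hscale hhoused hvol hvN₀ hcv hpre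
  hA hlaw hβ hfan hamp

/-- **ROOT-C OF RECORD ON THE SAME-LATTICE FACE, SUPPLIERS WIRED, (I4′) SOCKETED** [bookkeeping]: the owner's
`dressedStabilityStrict_of_sameLattice` BY NAME (ONE application) with its structural per-`(p, K)` families SUPPLIED — `hS`∕`hcount` from
the anchoring (row S3i `count_of_anchoring_cell`; `Λ = L ^ 4` is that count's rate), `hbirth` from the ℝ-step anchored seam at
`uniformConstantsOf L 1 (4c_δ) c̄ …` (row S5e `hbirth_of_rstep_anchored`, row S5b `absorbSmall_of_le` at `vR·mB`) — and the chart-level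
transport input PRODUCED on `ℤ^d` from the (I4′) data: `hlin` by N0f's `hlin_of_twoSidedRegularity`, `hdefw` by `hdefw_of_window`,
`hrate` by `le_rfl` (the defect IS `c_δ·r·(L⁻²)^(k−k′)`), `hmove` by `latMove_zero`, for `rel := BlockRel (Lg p K b k′) (zg p K b k′)`,
`move := latMove`, `Nw := latN`.  The scalars precede `∀ p K` (k1).  DISPLAYED: F-1 at birth + invariance, the (I4′) socket
(`hr`∕`ha`∕`hnorm`∕`hw` + the header's `hpair`), (w5) `hreg`, (w5b) `hlaw` with `hpre`∕`hβ`, anchoring ∕ component ∕ ℝ-step DATA.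
«ROOT-C ⇐ the named binders» — a REDUCTION BY NAME, NOT «NE1′ proved»; the same-lattice READING and wall v1.5-proposed are the owner's, of
record only on the second reading. [folklore] -/
theorem dressedStabilityStrict_of_suppliedSameLattice
    (hnorm : ∀ p K b k', ((d : ℝ) - 1) * ((Lg p K b k' : ℝ) - 1) * (a₁ p K b k' + a₀ p K b k') ≤ cδ * r p K b k')
    (hpair : ∀ (p : P) (K : ℕ) (b : (𝒯.B p K).Birth) (k' k : ℕ), (𝒯.B p K).birthScale b ≤ k' → k' ≤ k → k ≤ (𝒯.B p K).K →
      RanBelow (budgetGate (𝒯.T p K) (s₀ p K) m (S p K) (4 * cδ) (fun _ : ℕ => (L ^ 2)⁻¹ * 1)) k → ∀ ε > 0,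
      ∃ U₀ U₁ : Cfg d R, val U₀ ∈ 𝒦 p K b k' ∧ (∀ x ν, UnitaryLike (U₀ x ν)) ∧ (∀ x ν, UnitaryLike (U₁ x ν)) ∧
        PlaqSup (Lg p K b k') (zg p K b k') (fun y ρ ν => ‖(plaq U₁ y ρ ν : R) - 1‖)
          (a₁ p K b k' * ((L ^ 2)⁻¹) ^ (k - k')) ∧
        PlaqSup (Lg p K b k') (zg p K b k') (fun y ρ ν => ‖(plaq U₀ y ρ ν : R) - 1‖)
          (a₀ p K b k' * ((L ^ 2)⁻¹) ^ (k - k')) ∧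
        (𝒯.T p K).lin b k' k ≤ ‖Fn p K b k' (val U₁) - Fn p K b k' (val U₀)‖ + ε) :
    DressedStabilityStrict 𝒯 (L ^ 4) := by
  have hC : 0 ≤ 4 * cδ := by positivity
  have hψ0 : 0 < (L ^ 2)⁻¹ := by positivity
  have hψ1 : (L ^ 2)⁻¹ ≤ 1 := inv_le_one_of_one_le₀ (one_le_pow₀ hL)
  have hLb0 : 0 < Lb := by
    have h : (0 : ℝ) < (Lb : ℝ) := by rw [hLb]; linarith
    exact_mod_cast h
  have hsm : β₀ + A * ((vR : ℝ) * mB) * A₀ * (1 - ρ')⁻¹ ≤ A₀ := absorbSmall_of_le hfan hamp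
  exact dressedStabilityStrict_of_sameLattice 𝒯 hL hcδ.le hcbar hN₀ hA₀ hm hloc hρ'1 hsmall c s₀ S hc0 hcb
    (fun p K => (count_of_anchoring_cell (Anch p K) hLb hL (hmult p K) (hscale p K) (hhoused p K) (hvol p K) hvN₀).1)
    (fun p K => (count_of_anchoring_cell (Anch p K) hLb hL (hmult p K) (hscale p K) (hhoused p K) (hvol p K) hvN₀).2) hs₀
    (fun p K => hbirth_of_rstep_anchored
      (uniformConstantsOf L 1 (4 * cδ) cbar N₀ A₀ m sbar ρ' hL zero_le_one hC hcbar hN₀ hA₀ hm hloc hρ'1 hsmall)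
      (𝒯.T p K) (Rs p K) (fun _ : ℕ => (L ^ 2)⁻¹ * 1) (s₀ p K) (S p K) (Anch p K) hLb0 (hmult p K) (hcv p K)
      (by rw [uniformConstantsOf_Λ, ← hLb]) hA (hpre p K) (hlaw p K) (hβ p K) hsm)
    hreg Fn (fun p K b k' => BlockRel (Lg p K b k') (zg p K b k')) 𝒦 (fun _ _ _ _ => latN) w r
    (fun p K b k' k => cδ * r p K b k' * ((L ^ 2)⁻¹) ^ (k - k'))
    hinv hsl latMove_zero hr
    (fun p K => hdefw_of_window hcδ.le (fun b k' => (hr p K b k').le) hψ0.le hψ1 (hw p K))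
    (fun p K b k' k _ _ _ => le_rfl)
    (fun p K => hlin_of_twoSidedRegularity (T := 𝒯.T p K) hcδ (hr p K) hψ0 (ha p K) (hnorm p K) (hpair p K))

/-! ## §2 The headline and ROOT-B on the same-lattice face -/

/-- **THE HEADLINE ROOT ON THE SAME-LATTICE FACE** [bookkeeping]: `DressedStability 𝒯` from the strict root (owner's
`dressedStability_of_sameLattice_strict` BY NAME). [folklore] -/
theorem dressedStability_of_suppliedSameLattice
    (hnorm : ∀ p K b k', ((d : ℝ) - 1) * ((Lg p K b k' : ℝ) - 1) * (a₁ p K b k' + a₀ p K b k') ≤ cδ * r p K b k')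
    (hpair : ∀ (p : P) (K : ℕ) (b : (𝒯.B p K).Birth) (k' k : ℕ), (𝒯.B p K).birthScale b ≤ k' → k' ≤ k → k ≤ (𝒯.B p K).K →
      RanBelow (budgetGate (𝒯.T p K) (s₀ p K) m (S p K) (4 * cδ) (fun _ : ℕ => (L ^ 2)⁻¹ * 1)) k → ∀ ε > 0,
      ∃ U₀ U₁ : Cfg d R, val U₀ ∈ 𝒦 p K b k' ∧ (∀ x ν, UnitaryLike (U₀ x ν)) ∧ (∀ x ν, UnitaryLike (U₁ x ν)) ∧
        PlaqSup (Lg p K b k') (zg p K b k') (fun y ρ ν => ‖(plaq U₁ y ρ ν : R) - 1‖)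
          (a₁ p K b k' * ((L ^ 2)⁻¹) ^ (k - k')) ∧
        PlaqSup (Lg p K b k') (zg p K b k') (fun y ρ ν => ‖(plaq U₀ y ρ ν : R) - 1‖)
          (a₀ p K b k' * ((L ^ 2)⁻¹) ^ (k - k')) ∧
        (𝒯.T p K).lin b k' k ≤ ‖Fn p K b k' (val U₁) - Fn p K b k' (val U₀)‖ + ε) :
    DressedStability 𝒯 :=
  dressedStability_of_sameLattice_strict 𝒯
    (dressedStabilityStrict_of_suppliedSameLattice 𝒯 Anch Rs hL hcδ hcbar hN₀ hA₀ hm hloc hρ'1 hsmall hsl hinv hr ha hw hc0 hcb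
      hs₀ hreg hLb hmult hscale hhoused hvol hvN₀ hcv hpre hA hlaw hβ hfan hamp hnorm hpair)

/-- **ROOT-B ON THE SAME-LATTICE FACE** [bookkeeping]: with nonnegative cube weights bounded by `w̄` and the bookings' positional count
read off the SAME anchoring (row S3i `positionalCount_of_anchoring_cell`, `1 ≤ v` so that `mB ≤ v·mB ≤ N₀`), `DressedBudget 𝒯 wt` —
the owner's `dressedBudget_of_sameLattice_strict` BY NAME. [folklore] -/
theorem dressedBudget_of_suppliedSameLattice
    (hnorm : ∀ p K b k', ((d : ℝ) - 1) * ((Lg p K b k' : ℝ) - 1) * (a₁ p K b k' + a₀ p K b k') ≤ cδ * r p K b k')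
    (hpair : ∀ (p : P) (K : ℕ) (b : (𝒯.B p K).Birth) (k' k : ℕ), (𝒯.B p K).birthScale b ≤ k' → k' ≤ k → k ≤ (𝒯.B p K).K →
      RanBelow (budgetGate (𝒯.T p K) (s₀ p K) m (S p K) (4 * cδ) (fun _ : ℕ => (L ^ 2)⁻¹ * 1)) k → ∀ ε > 0,
      ∃ U₀ U₁ : Cfg d R, val U₀ ∈ 𝒦 p K b k' ∧ (∀ x ν, UnitaryLike (U₀ x ν)) ∧ (∀ x ν, UnitaryLike (U₁ x ν)) ∧
        PlaqSup (Lg p K b k') (zg p K b k') (fun y ρ ν => ‖(plaq U₁ y ρ ν : R) - 1‖)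
          (a₁ p K b k' * ((L ^ 2)⁻¹) ^ (k - k')) ∧
        PlaqSup (Lg p K b k') (zg p K b k') (fun y ρ ν => ‖(plaq U₀ y ρ ν : R) - 1‖)
          (a₀ p K b k' * ((L ^ 2)⁻¹) ^ (k - k')) ∧
        (𝒯.T p K).lin b k' k ≤ ‖Fn p K b k' (val U₁) - Fn p K b k' (val U₀)‖ + ε)
    {wt : P → ℕ → ℕ → ℝ} {wbar : ℝ} (hwbar : 0 ≤ wbar)
    (hw0 : ∀ p K, ∀ j ≤ K, 0 ≤ wt p K j) (hwb : ∀ p K, ∀ j ≤ K, wt p K j ≤ wbar) (hv : 1 ≤ v) :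
    DressedBudget 𝒯 wt :=
  have hmN₀ : (mB : ℝ) ≤ N₀ := by
    have h1 : (1 : ℝ) ≤ (v : ℝ) := by exact_mod_cast hv
    have hmB : (0 : ℝ) ≤ (mB : ℝ) := by positivity
    nlinarith
  dressedBudget_of_sameLattice_strict 𝒯
    (dressedStabilityStrict_of_suppliedSameLattice 𝒯 Anch Rs hL hcδ hcbar hN₀ hA₀ hm hloc hρ'1 hsmall hsl hinv hr ha hw hc0 hcb
      hs₀ hreg hLb hmult hscale hhoused hvol hvN₀ hcv hpre hA hlaw hβ hfan hamp hnorm hpair)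
    hN₀ hwbar hw0 hwb fun p K => positionalCount_of_anchoring_cell (Anch p K) hLb hL (hmult p K) hmN₀

end EndAll

/-! ## §3 The scalar door at continuation factor one (decided arithmetic of the cell's shapes) -/

/-- [arith] With `2 ≤ L` and `16·L·c_δ·c̄ ≤ 1` the located largeness of §1 is met at `ρ′ = 3∕4` (N0f `locOf_one_le_of_small` BY
NAME), and the (w6) window then reads `4·m·N₀·A₀ ≤ 1 − s̄⁰`. -/
example {L cδ cbar m N₀ A₀ sbar : ℝ} (hL : 2 ≤ L) (hsmall : 16 * L * cδ * cbar ≤ 1)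
    (hwin : 4 * m * (N₀ * A₀) ≤ 1 - sbar) :
    locOf L 1 (4 * cδ) cbar ≤ 3 / 4 ∧ m * (N₀ * A₀ * (1 - 3 / 4)⁻¹) ≤ 1 - sbar :=
  ⟨locOf_one_le_of_small hL hsmall, by norm_num; linarith⟩

end Summit.QuantumFields.BalabanUV.T4Continuum.NE1p.DressedStabilityStrictOfSuppliedSameLattice

end
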